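import Summits.CriticalPhenomena.PercolationContinuityZ3.Theorems.PercNearOneGluingNoHeavyLowerTailMajorityGluingQCertSymParts
import HarnessLib

/-!
# Part 12 of 18 of the orbit certificate of the cell `(12,7)` at `c = 157/100`: data and digest (lane prim-rate, constants-miner 1, gen 36; generated by cert/mksym.py)

Support file for the closed crux `NoHeavyLowerTail` (stmt-CriticalPhenomena-4575), majority-gluing line.  The symmetrised certificate of the cell `(12,7)`
(kit j286395, symcert.py) is checked IN PARTS (`…MajorityGluingQCertSymParts`): this file holds part 12 (1 multiplier terms, 1 marginal slacks,
0 rows, 0 squares; 3636 contributions) and its DIGEST `twelveSevenSymP12D` (65 orbit keys), verified by `decide +kernel` (`twelveSevenSymP12_digest`).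
The parts are glued in `…MajorityGluingQCertSymTwelveSeven`.  No sorries. [cite: VandenbergKahn2001, Thm 1.2 (p. 123)]
-/

namespace Summit.CriticalPhenomena.PercolationContinuityZ3.Theorems

namespace HubOnly
namespace QCert

/-- Row representatives of part 12: `(A, X, B, Y, n, masks of f(A,X), f(B,Y), f(A∪B,X∩Y), f(∅,X∪Y))`. -/
def twelveSevenSymP12Rows : List RowE :=
  []

/-- Square representatives of part 12: `(a, b, n, mask₁, mask₂)`. -/
def twelveSevenSymP12Sqs : List SqE :=
  []

/-- **Part 12** of the `(12,7)` orbit certificate at `157/100`. -/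
def twelveSevenSymP12 : SymCert :=
  ⟨⟨12, 7, 157, 100, 1, [], [], []⟩,
    [(127, 290306106972965632)],
    [(0, 62, 50000000)],
    [twelveSevenSymP12Rows], [twelveSevenSymP12Sqs]⟩

/-- The digest of part 12: `(orbit key, coefficient total)` in increasing key order (computed by cert/mksym.py, verified below). -/
def twelveSevenSymP12D : List (ℕ × ℤ) :=
  [((4159 : ℕ), (50000000 : ℤ)), (12352, 250000000), (12415, 300000000), (28738, 500000000), (28800, 1500000000), (28927, 750000000), 
    (61510, 500000000), (61570, 3000000000), (61696, 3750000000), (61951, 1000000000), (127054, 250000000), (127070, 50000000), (127110, 3000000000), 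
    (127118, 1500000000), (127134, 300000000), (127234, 7500000000), (127238, 7500000000), (127246, 3750000000), (127262, 750000000), 
    (127488, 5000000000), (127490, 10000000000), (127494, 10000000000), (127502, 5000000000), (127518, 1000000000), (127999, 750000000), 
    (128000, 3750000000), (128002, 7500000000), (128006, 7500000000), (128014, 3750000000), (128030, 750000000), (129023, 300000000), 
    (129024, 1500000000), (129026, 3000000000), (129030, 3000000000), (129038, 1500000000), (129054, 300000000), (131071, 50000000), 
    (131072, 250000000), (131074, 500000000), (131078, 500000000), (131086, 250000000), (131102, 50000000), (520446, -29030610697296563200), 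
    (520510, -1016071374405379712000), (520574, -145153053486482816000), (520734, -6096428246432278272000), (520766, -2032142748810759424000), 
    (520830, -290306106972965632000), (521230, -10160713744053797120000), (521246, -6096428246432278272000), (521278, -2032142748810759424000), 
    (521342, -290306106972965632000), (522246, -5080356872026898560000), (522254, -5080356872026898560000), (522270, -3048214123216139136000), 
    (522302, -1016071374405379712000), (522366, -145153053486482816000), (524290, -609642824643227827200), (524294, -1016071374405379712000), 
    (524302, -1016071374405379712000), (524318, -609642824643227827200), (524350, -203214274881075942400), (524414, -29030610697296563200), 
    (16781343, -50000000), (16781439, 45578058794755604224)]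

/-- **The digest of part 12 is `twelveSevenSymP12D`** (kernel evaluation of the part's 3636 contributions). -/
theorem twelveSevenSymP12_digest : twelveSevenSymP12.digest 20 = twelveSevenSymP12D := by
  decide +kernel

end QCert
end HubOnly

end Summit.CriticalPhenomena.PercolationContinuityZ3.Theorems
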